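import Summits.KontsevichZagierPeriods.KontsevichZagierPeriods.Theorems.UnfoldedStokesStokesGenerationStubRungCertificate
import Summits.KontsevichZagierPeriods.KontsevichZagierPeriods.Theorems.UnfoldedStokesStokesGenerationStubRungInhomBaker
import Summits.KontsevichZagierPeriods.KontsevichZagierPeriods.Theorems.UnfoldedStokesStokesGenerationStubRungDlogProd
import Summits.KontsevichZagierPeriods.KontsevichZagierPeriods.Theorems.UnfoldedStokesStokesGenerationStubRungDlogValue
import Summits.KontsevichZagierPeriods.KontsevichZagierPeriods.Theorems.UnfoldedStokesStokesGenerationStubRungExactElement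
import Summits.KontsevichZagierPeriods.KontsevichZagierPeriods.Theorems.InverseLandauTateLiftingBakerDecomposition
import Literature.NumberTheory.Transcendental.SemialgebraicAlgebraicPoints

/-!
# `StokesGeneration` (stmt-KontsevichZagierPeriods-3586), line `fibrewise_stokes` — the residual S2 on the dlog sector

Crux `Summit.KontsevichZagierPeriods.KontsevichZagierPeriods.Theses.UnfoldedStokes.StokesGeneration` (kernel-checked
equivalent to the summit). Line `fibrewise_stokes` reduces it to the residual S2 = `FibrewiseStokesGenerationConjecture`
(`Theorems/FibrewiseStokesGenerationConjecture.lean`): every bounded closed-cube representation of value `0` is, after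
padding and off a null `ℚ`-semialgebraic set, a finite sum of FIBREWISE STOKES ELEMENTS `D − (G|_{xᵢ=1} − G|_{xᵢ=0})`.

This file proves S2 — with exactly its conclusion, `M' = 2`, no kink sets, no null set — on the DLOG SECTOR WITH AN
EXACT PART: one-variable integrands
`h(z) = g₀(z) + Σᵢ cᵢ pᵢ'(z)/pᵢ(z)` on `[0,1]`,
where `G₀' = g₀` (`G₀, g₀` `ℚ`-semialgebraic: the exact part), the `pᵢ` are polynomials with real algebraic
coefficients POSITIVE on `[0,1]` and the `cᵢ` are real algebraic (the dlog part; `pᵢ = 1 − z/aᵢ` is the Baker sector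
of `…FibrewiseRungSimpleRealPoles.lean`, `pᵢ = (z − uᵢ)² + vᵢ²` the modulus part of a pair of complex-conjugate
poles). Unconditionally:

1. the value is `(G₀(1) − G₀(0)) + Σᵢ cᵢ log(pᵢ(1)/pᵢ(0))` (`stub_rungDlogValue`, p125027);
2. `G₀(1) − G₀(0)` is ALGEBRAIC (values of `ℚ`-semialgebraic functions at rational points,
   `IsSemialgebraicFunOn.isAlgebraic_apply`), so if the value vanishes the INHOMOGENEOUS form of Baker's theorem
   (`stub_rungInhomBaker`, p125029 — from the tree's proved `baker_holds`) forces `G₀(1) = G₀(0)`;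
3. Baker's decomposition (`tateLifting_bakerDecomposition`) writes `c = Σ_q γ_q M_q`, `γ_q` real algebraic,
   `M_q ∈ ℤ^s` with `Πᵢ (pᵢ(1)/pᵢ(0))^{M_q i} = 1`;
4. each relation gives the normalised product `P = Πᵢ (pᵢ/pᵢ(0))^{Mᵢ}`, `P > 0` on `[0,1]`, `P(0) = P(1) = 1`,
   `P'/P = Σᵢ Mᵢ pᵢ'/pᵢ` (`stub_rungDlogProd`, p125139), fed to the landed TWO-ELEMENT divergence certificate
   (`stub_rungCertificate`, p124720): `γ P'/P = ∂₀G₀ + ∂₁G₁` on `[0,1]²`, all boundary terms vanishing;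
5. the exact part is ONE fibrewise Stokes element in direction `0` with primitive `G₀(x 0)` and integrand
   `g₀(x 0) − (G₀(1) − G₀(0)) = g₀(x 0)` (`stub_rungExactElement`, p125062);
6. concatenation (`2t + 1` elements) gives the conclusion of S2.

So every vanishing `ℚ̄ ∩ ℝ`-linear combination of `1` and real logarithms of positive real algebraic numbers that this
sector produces is generated — in the strict economy of the line (fibrewise Newton–Leibniz elements in one extra
variable only; no change of variables, no domain additivity) — exactly as the residual conjecture predicts.

References: A. Baker, *Transcendental Number Theory* (1975), Thm. 2.1; M. Kontsevich, D. Zagier, *Periods* (2001),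
§1.1–1.2; J. Ayoub, Ann. of Math. 181 (2015), Conj. 1.1, Rem. 1.5; J. Fresán, *Une introduction aux périodes* (2024),
Conj. 3.5, Rem. 3.7.
-/

noncomputable section

set_option linter.dupNamespace false

namespace Summit.KontsevichZagierPeriods.KontsevichZagierPeriods.Cruxes.StokesGeneration.FibrewiseStokes

open MeasureTheory Set
open Literature.NumberTheory.Transcendental
open Literature.NumberTheory.Transcendental.KZ
open Literature.ModelTheory.ExponentialFields (IsSemialgebraic)

/-- The value at a rational point of a polynomial with real algebraic coefficients is algebraic. [folklore] -/
theorem isAlgebraic_eval_ratCast (f : Polynomial ℝ) (hf : ∀ n, IsAlgebraic ℚ (f.coeff n)) (r : ℚ) :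
    IsAlgebraic ℚ (f.eval (r : ℝ)) := by
  rw [Polynomial.eval_eq_sum_range]
  refine mem_algebraicClosure_iff.mp (sum_mem fun n _ => mul_mem (mem_algebraicClosure_iff.mpr (hf n))
    (pow_mem (SubfieldClass.ratCast_mem _ r) n))

/-- **S2 on the dlog sector with an exact part (rung 2, assembled; lead c2).** A closed-interval representation
with integrand `g₀(z) + Σᵢ cᵢ pᵢ'(z)/pᵢ(z)` — `G₀' = g₀` the exact part (`G₀, g₀` `ℚ`-semialgebraic, so `G₀(1) − G₀(0)`
is algebraic, `IsSemialgebraicFunOn.isAlgebraic_apply`), `pᵢ` polynomials with real algebraic coefficients positive on `[0,1]`, `cᵢ` real algebraic — and value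
`0` satisfies the conclusion of `FibrewiseStokesGeneration` with `M' = 2`: inhomogeneous Baker kills the constant,
Baker's decomposition reduces the logarithms to integer multiplicative relations, each certified by two fibrewise
Stokes elements, plus one element for the exact part. [cite: Baker1975, Thm 2.1] -/
theorem fibrewiseStokesGeneration_dlogSector :
    ∀ (s : ℕ) (p : Fin s → Polynomial ℝ) (c : Fin s → ℝ) (G₀ g₀ : ℝ → ℝ),
      (∀ i n, IsAlgebraic ℚ ((p i).coeff n)) → (∀ i, IsAlgebraic ℚ (c i)) →
      (∀ i, ∀ u ∈ Set.Icc (0:ℝ) 1, 0 < (p i).eval u) →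
      IsSemialgebraicFunOn ℚ (Set.pi Set.univ (fun _ : Fin 2 => Set.Icc (0:ℝ) 1)) (fun x => G₀ (x 0)) →
      IsSemialgebraicFunOn ℚ (Set.pi Set.univ (fun _ : Fin 2 => Set.Icc (0:ℝ) 1)) (fun x => g₀ (x 0)) →
      (∀ u ∈ Set.Icc (0:ℝ) 1, HasDerivAt G₀ (g₀ u) u) → ContinuousOn g₀ (Set.Icc (0:ℝ) 1) →
      ∀ (t : IntegralRep 1), t.domain = Set.pi Set.univ (fun _ : Fin 1 => Set.Icc (0:ℝ) 1) →
      (∀ z ∈ Set.pi Set.univ (fun _ : Fin 1 => Set.Icc (0:ℝ) 1), t.integrand z =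
        g₀ (z 0) + ∑ i, c i * ((Polynomial.derivative (p i)).eval (z 0) / (p i).eval (z 0))) →
      t.value = 0 →
    ∃ (M' : ℕ) (hMM' : 1 ≤ M') (J : ℕ) (i : Fin J → Fin M') (G D : Fin J → (Fin M' → ℝ) → ℝ)
      (K : Fin J → Set (Fin M' → ℝ)) (q : Fin J → IntegralRep M') (Z : Set (Fin M' → ℝ)),
      (∀ j, IsSemialgebraicFunOn ℚ (Set.pi Set.univ (fun _ : Fin M' => Set.Icc (0:ℝ) 1)) (G j) ∧
        IsSemialgebraicFunOn ℚ (Set.pi Set.univ (fun _ : Fin M' => Set.Icc (0:ℝ) 1)) (D j) ∧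
        IsSemialgebraic ℚ (K j) ∧
        (∃ B : ℝ, ∀ x ∈ Set.pi Set.univ (fun _ : Fin M' => Set.Icc (0:ℝ) 1), |(G j) x| ≤ B) ∧
        (∀ x ∈ Set.pi Set.univ (fun _ : Fin M' => Set.Icc (0:ℝ) 1), Set.Finite {s : ℝ | Function.update x (i j) s ∈ (K j)}) ∧
        (∀ x ∈ Set.pi Set.univ (fun _ : Fin M' => Set.Icc (0:ℝ) 1), ContinuousOn (fun s : ℝ => (G j) (Function.update x (i j) s)) (Set.Icc (0:ℝ) 1)) ∧
        (∀ x ∈ Set.pi Set.univ (fun _ : Fin M' => Set.Icc (0:ℝ) 1), x ∉ (K j) → x (i j) ∈ Set.Ioo (0:ℝ) 1 →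
          HasDerivAt (fun s : ℝ => (G j) (Function.update x (i j) s)) ((D j) x) (x (i j)))) ∧
      (∀ j, (q j).domain = Set.pi Set.univ (fun _ : Fin M' => Set.Icc (0:ℝ) 1) ∧
        ∀ x ∈ Set.pi Set.univ (fun _ : Fin M' => Set.Icc (0:ℝ) 1), (q j).integrand x =
          D j x - (G j (Function.update x (i j) 1) - G j (Function.update x (i j) 0))) ∧
      IsSemialgebraic ℚ Z ∧ volume Z = 0 ∧
      ∀ x ∈ Set.pi Set.univ (fun _ : Fin M' => Set.Icc (0:ℝ) 1), x ∉ Z →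
        t.integrand (fun l => x (Fin.castLE hMM' l)) = ∑ j, (q j).integrand x := by
  intro s p c G₀ g₀ hp hc hpos hG₀ hg₀ hder hg₀c t ht hti hval
  classical
  -- positivity / algebraicity of `αᵢ = pᵢ(1)/pᵢ(0)`; algebraicity of `G₀(1) − G₀(0)`
  have h0 : (0:ℝ) ∈ Set.Icc (0:ℝ) 1 := ⟨le_rfl, zero_le_one⟩
  have h1 : (1:ℝ) ∈ Set.Icc (0:ℝ) 1 := ⟨zero_le_one, le_rfl⟩
  have hβ : IsAlgebraic ℚ (G₀ 1 - G₀ 0) := by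
    have e1 := hG₀.isAlgebraic_apply (a := fun _ => (1:ℝ)) (fun _ _ => h1) fun _ => isAlgebraic_one
    have e0 := hG₀.isAlgebraic_apply (a := fun _ => (0:ℝ)) (fun _ _ => h0) fun _ => isAlgebraic_zero
    exact mem_algebraicClosure_iff.mp
      (sub_mem (mem_algebraicClosure_iff.mpr e1) (mem_algebraicClosure_iff.mpr e0))
  have hαpos : ∀ i, 0 < (p i).eval 1 / (p i).eval 0 := fun i => div_pos (hpos i 1 h1) (hpos i 0 h0)
  have hαalg : ∀ i, IsAlgebraic ℚ ((p i).eval 1 / (p i).eval 0) := fun i => by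
    have e1 := isAlgebraic_eval_ratCast (p i) (hp i) 1
    have e0 := isAlgebraic_eval_ratCast (p i) (hp i) 0
    simp only [Rat.cast_one, Rat.cast_zero] at e1 e0
    exact mem_algebraicClosure_iff.mp
      (div_mem (mem_algebraicClosure_iff.mpr e1) (mem_algebraicClosure_iff.mpr e0))
  -- the value, and the inhomogeneous Baker step
  have hv := stub_rungDlogValue s p c G₀ g₀ hpos hder hg₀c t ht hti
  rw [hval] at hv
  have hβ0 : G₀ 1 - G₀ 0 = 0 :=
    stub_rungInhomBaker s (fun i => (p i).eval 1 / (p i).eval 0) c (G₀ 1 - G₀ 0) hαpos hαalg hc hβ hv.symm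
  have hsum : ∑ i, c i * Real.log ((p i).eval 1 / (p i).eval 0) = 0 := by
    rw [hβ0, zero_add] at hv; exact hv.symm
  -- Baker's decomposition of `c`
  obtain ⟨tq, Mq, γ, hγ, hMq, hcM⟩ :=
    Summit.KontsevichZagierPeriods.InverseLandau.tateLifting_bakerDecomposition s
      (fun i => (p i).eval 1 / (p i).eval 0) c hαpos hαalg hc hsum
  -- normalised products and the two-element certificates
  set P : Fin tq → ℝ → ℝ := fun q u => ∏ i, ((p i).eval u / (p i).eval 0) ^ (Mq q i) with hP
  set P' : Fin tq → ℝ → ℝ := fun q u =>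
    P q u * ∑ i, (Mq q i : ℝ) * ((Polynomial.derivative (p i)).eval u / (p i).eval u) with hP'
  have hR5 := fun q => stub_rungDlogProd s p (Mq q) (P q) (P' q) hp hpos (hMq q)
    (fun u => rfl) (fun u => rfl)
  have hR2 : ∀ q, ∃ (G D : Fin 2 → (Fin 2 → ℝ) → ℝ) (r : Fin 2 → IntegralRep 2),
      (∀ j, IsSemialgebraicFunOn ℚ (Set.pi Set.univ (fun _ : Fin 2 => Set.Icc (0:ℝ) 1)) (G j) ∧
        IsSemialgebraicFunOn ℚ (Set.pi Set.univ (fun _ : Fin 2 => Set.Icc (0:ℝ) 1)) (D j) ∧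
        (∃ B : ℝ, ∀ x ∈ Set.pi Set.univ (fun _ : Fin 2 => Set.Icc (0:ℝ) 1), |(G j) x| ≤ B) ∧
        (∀ x ∈ Set.pi Set.univ (fun _ : Fin 2 => Set.Icc (0:ℝ) 1),
          ContinuousOn (fun s : ℝ => (G j) (Function.update x j s)) (Set.Icc (0:ℝ) 1)) ∧
        (∀ x ∈ Set.pi Set.univ (fun _ : Fin 2 => Set.Icc (0:ℝ) 1), x j ∈ Set.Ioo (0:ℝ) 1 →
          HasDerivAt (fun s : ℝ => (G j) (Function.update x j s)) ((D j) x) (x j))) ∧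
      (∀ j, (r j).domain = Set.pi Set.univ (fun _ : Fin 2 => Set.Icc (0:ℝ) 1) ∧
        ∀ x ∈ Set.pi Set.univ (fun _ : Fin 2 => Set.Icc (0:ℝ) 1), (r j).integrand x =
          D j x - (G j (Function.update x j 1) - G j (Function.update x j 0))) ∧
      ∀ x ∈ Set.pi Set.univ (fun _ : Fin 2 => Set.Icc (0:ℝ) 1),
        γ q * (P' q (x 0) / P q (x 0)) = ∑ j, (r j).integrand x := fun q =>
    stub_rungCertificate (γ q) (P q) (P' q) (hγ q) (hR5 q).1 (hR5 q).2.1 (hR5 q).2.2.1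
      (hR5 q).2.2.2.1 (hR5 q).2.2.2.2.1 (hR5 q).2.2.2.2.2.1 (hR5 q).2.2.2.2.2.2.1
      (hR5 q).2.2.2.2.2.2.2.1
  choose G D r hGD hr hid using hR2
  -- the exact element
  obtain ⟨Ge, De, qe, hGe, hqe, hide⟩ := stub_rungExactElement G₀ g₀ hG₀ hg₀
    (HasDerivAt.continuousOn fun u hu => hder u hu) hg₀c (fun u hu => hder u (Set.Ioo_subset_Icc_self hu))
  -- concatenate: `2 · tq` certificate elements, then the exact element last
  set e : Fin tq × Fin 2 ≃ Fin (tq * 2) := finProdFinEquiv with he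
  refine ⟨2, by norm_num, tq * 2 + 1,
    Fin.snoc (fun j => (e.symm j).2) 0,
    Fin.snoc (fun j => G (e.symm j).1 (e.symm j).2) Ge,
    Fin.snoc (fun j => D (e.symm j).1 (e.symm j).2) De,
    fun _ => ∅,
    Fin.snoc (fun j => r (e.symm j).1 (e.symm j).2) qe, ∅,
    fun j => ?_, fun j => ?_,
    Literature.ModelTheory.ExponentialFields.isSemialgebraic_empty, measure_empty, ?_⟩
  · refine Fin.lastCases ?_ (fun j => ?_) j
    · simp only [Fin.snoc_last]
      obtain ⟨h1, h2, h3, h4, h5⟩ := hGe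
      exact ⟨h1, h2, Literature.ModelTheory.ExponentialFields.isSemialgebraic_empty, h3,
        fun x _ => by simp, h4, fun x hx _ hxj => h5 x hx hxj⟩
    · simp only [Fin.snoc_castSucc]
      obtain ⟨h1, h2, h3, h4, h5⟩ := hGD (e.symm j).1 (e.symm j).2
      exact ⟨h1, h2, Literature.ModelTheory.ExponentialFields.isSemialgebraic_empty, h3,
        fun x _ => by simp, h4, fun x hx _ hxj => h5 x hx hxj⟩
  · refine Fin.lastCases ?_ (fun j => ?_) j
    · simp only [Fin.snoc_last]; exact hqe
    · simp only [Fin.snoc_castSucc]; exact hr (e.symm j).1 (e.symm j).2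
  · intro x hx _
    have hx0 : x 0 ∈ Set.Icc (0:ℝ) 1 := hx 0 (Set.mem_univ _)
    have hx1 : (fun l : Fin 1 => x (Fin.castLE (by norm_num : 1 ≤ 2) l)) ∈
        Set.pi Set.univ (fun _ : Fin 1 => Set.Icc (0:ℝ) 1) := fun l _ => hx _ (Set.mem_univ _)
    rw [hti _ hx1]
    have hcast : x (Fin.castLE (by norm_num : 1 ≤ 2) 0) = x 0 := rfl
    simp only [hcast]
    rw [Fin.sum_univ_castSucc]
    simp only [Fin.snoc_castSucc, Fin.snoc_last]
    -- the certificate block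
    have hrhs : ∑ j : Fin (tq * 2), (r (e.symm j).1 (e.symm j).2).integrand x =
        ∑ q, γ q * ∑ i, (Mq q i : ℝ) * ((Polynomial.derivative (p i)).eval (x 0) / (p i).eval (x 0)) := by
      rw [e.symm.sum_comp (fun pr : Fin tq × Fin 2 => (r pr.1 pr.2).integrand x), Fintype.sum_prod_type]
      refine Finset.sum_congr rfl fun q _ => ?_
      rw [← hid q x hx, (hR5 q).2.2.2.2.2.2.2.2 (x 0) hx0]
    rw [hrhs, hide x hx, hβ0, sub_zero, add_comm]
    congr 1
    calc ∑ i, c i * ((Polynomial.derivative (p i)).eval (x 0) / (p i).eval (x 0))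
        = ∑ i, (∑ q, γ q * (Mq q i : ℝ)) *
            ((Polynomial.derivative (p i)).eval (x 0) / (p i).eval (x 0)) := by simp only [← hcM]
      _ = ∑ i, ∑ q, γ q * ((Mq q i : ℝ) *
            ((Polynomial.derivative (p i)).eval (x 0) / (p i).eval (x 0))) := by
          simp only [Finset.sum_mul, mul_assoc]
      _ = ∑ q, γ q * ∑ i, (Mq q i : ℝ) *
            ((Polynomial.derivative (p i)).eval (x 0) / (p i).eval (x 0)) := by
          rw [Finset.sum_comm]; simp only [Finset.mul_sum]

end Summit.KontsevichZagierPeriods.KontsevichZagierPeriods.Cruxes.StokesGeneration.FibrewiseStokes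

end
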